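import Literature.Computability.QuantumComplexity.CompilerCodeFPBasic
import HarnessLib

/-!
# Typed polynomial time for the braid compiler, II: tower, level step, descent, compile

Topic `Literature/Computability/QuantumComplexity`, sequel of `CompilerCodeFPBasic.lean`
(Aharonov–Arad 2011, Thm. 3.1, §3.3: the classical pre-compilation is polynomial). The remaining
stages of `ExactCompiler.compile` as typed `FP` maps. Loops whose accumulator words grow
geometrically (the commutator tower, the descent) or linearly in a unary count (powers) are run
through the capped fold `foldlCap`/`powCap`; the CAPPED versions defined here — `towerCap`,
`findJCap`, `levelCandsCap`, `levelStepCap`, `descendCap`, `compileCap` — take the cap and the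
search bound `Jmax` in unary and are typed polynomial time outright (`…_codeFP`), and each agrees
with its plain counterpart as soon as no intermediate code exceeds the cap (`…_eq`, hypotheses on
the plain run, discharged from word-length bounds in the sequel).

## References

* D. Aharonov, I. Arad, New J. Phys. 13 (2011) 035019, §3.3 [AharonovArad2011].
* S. Arora, B. Barak, *Computational Complexity*, CUP 2009, §1.2–1.3 [AroraBarak2009].
-/

namespace Literature.Computability.QuantumComplexity

open Literature.Computability.Complexity Literature.Computability.Complexity.CodeFP ExactCompiler

/-! ### The tower -/

/-- **One level of the tower is typed polynomial time.** [cite: AharonovArad2011, §3.3] -/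
theorem towerStep_codeFP : CodeFP (pairE (rawE candE) candE) candE (fun p => towerStep p.1 p.2) := by
  -- the commutator candidates, with context `c` over the net
  have hg : CodeFP (pairE candE candE) candE (fun t => t.1.gcomm (t.2.conj t.1)) := candGcomm' (fst _ _) (candConj' (snd _ _) (fst _ _))
  have hcands : CodeFP (pairE (rawE candE) candE) (rawE candE) (fun p => p.1.map fun V => p.2.gcomm (V.conj p.2)) := by
    exact ((CodeFP.map hg).comp ((snd _ _).pair (fst _ _)) :)
  have hd : CodeFP (pairE (rawE candE) candE) candE (fun p => (p.1.map fun V => p.2.gcomm (V.conj p.2)).headD p.2) := by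
    exact ((rawHeadOr candE).comp ((snd _ _).pair hcands) :)
  have hb := bestByCtx (σ := Cand Letter) (eσ := candE) (α := Cand Letter) (eα := candE) ZPhiS.lt zphisLt
    (key := fun t => t.2.tr2) (candTr2' (snd _ _))
  exact ((hb.comp (((snd _ _).pair hd).pair hcands)).congr fun p => rfl)

/-- The tower with its last element, as a fold. [folklore] -/
def towerPairStep (net : List (Cand Letter)) (_ : Unit) (st : List (Cand Letter) × Cand Letter) : List (Cand Letter) × Cand Letter :=
  (st.1 ++ [towerStep net st.2], towerStep net st.2)

/-- **The tower, computed by the capped fold** (returns the list and its last element). [cite: AharonovArad2011, §3.3] -/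
def towerCap (cap : ℕ) (net : List (Cand Letter)) (c₀ : Cand Letter) (S : ℕ) : List (Cand Letter) × Cand Letter :=
  foldlCap (pairE (rawE candE) candE) cap towerPairStep net (List.replicate S ()) ([c₀], c₀)

/-- The last element of the tower. [folklore] -/
theorem tower_ne_nil (net : List (Cand Letter)) (c₀ : Cand Letter) : ∀ S, tower net c₀ S ≠ []
  | 0 => by simp [tower]
  | S + 1 => by simp [tower]

/-- The plain tower is the plain fold. [folklore] -/
theorem tower_eq_foldl (net : List (Cand Letter)) (c₀ : Cand Letter) : ∀ S : ℕ,
    (tower net c₀ S, (tower net c₀ S).getLastD c₀) = (List.replicate S ()).foldl (fun st u => towerPairStep net u st) ([c₀], c₀)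
  | 0 => rfl
  | S + 1 => by
    rw [List.replicate_succ', List.foldl_append, ← tower_eq_foldl net c₀ S, List.foldl_cons, List.foldl_nil, towerPairStep, tower]
    simp only [List.getLastD_eq_getLast?, List.getLast?_append, List.getLast?_singleton, Option.some_or, Option.getD_some]

/-- **`towerCap = tower` below the cap.** [folklore] -/
theorem towerCap_eq {cap : ℕ} {net : List (Cand Letter)} {c₀ : Cand Letter} {S : ℕ}
    (h : ∀ j ≤ S, (pairE (rawE candE) candE (tower net c₀ j, (tower net c₀ j).getLastD c₀)).length ≤ cap) :
    towerCap cap net c₀ S = (tower net c₀ S, (tower net c₀ S).getLastD c₀) := by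
  rw [towerCap, tower_eq_foldl]
  refine foldlCap_eq_foldl fun l₁ l₂ hl => ?_
  have hlen : l₁.length ≤ S := by
    have := congrArg List.length hl; rw [List.length_append, List.length_replicate] at this; omega
  have e : l₁ = List.replicate l₁.length () := List.eq_replicate_iff.2 ⟨rfl, fun u _ => by cases u; rfl⟩
  rw [e, ← tower_eq_foldl]
  exact h _ hlen

/-- **The capped tower is typed polynomial time** (cap and depth in unary). [cite: AharonovArad2011, §3.3] -/
theorem towerCap_codeFP : CodeFP (pairE (pairE unE (rawE candE)) (pairE candE unE)) (pairE (rawE candE) candE)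
    (fun p => towerCap p.1.1 p.1.2 p.2.1 p.2.2) := by
  have ht : CodeFP (pairE (rawE candE) (pairE unitE (pairE (rawE candE) candE))) candE (fun t => towerStep t.1 t.2.2.2) :=
    towerStep_codeFP.comp ((fst _ _).pair (snd _ _).snd'.snd')
  have hstep : CodeFP (pairE (rawE candE) (pairE unitE (pairE (rawE candE) candE))) (pairE (rawE candE) candE)
      (fun t => towerPairStep t.1 t.2.1 t.2.2) := by
    refine ((((rawAppend candE).comp ((snd _ _).snd'.fst'.pair ((rawSingleton candE).comp ht))).pair ht).congr fun t => rfl)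
  have hinit : CodeFP (pairE (rawE candE) candE) (pairE (rawE candE) candE) (fun q => ([q.2], q.2)) :=
    ((rawSingleton candE).comp (snd _ _)).pair (snd _ _)
  -- `foldlCap_codeFP` with context `net`, start depending on `c₀`: enlarge the context to `(net, c₀)`
  have h := foldlCap_codeFP (eβ := pairE (rawE candE) candE) (eα := unitE) (σ := List (Cand Letter) × Cand Letter)
    (eσ := pairE (rawE candE) candE) (step := fun q u st => towerPairStep q.1 u st) (init := fun q => ([q.2], q.2))
    (hstep.comp ((fst _ _).fst'.pair (snd _ _))) hinit
  refine ((h.comp ((((fst _ _).fst').pair ((fst _ _).snd'.pair (snd _ _).fst')).pair (replicateUnit.comp (snd _ _).snd'))).congr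
    fun p => ?_)
  rfl

/-! ### The power search -/

/-- `find?/getD` as `filter/headD`. [folklore] -/
theorem find?_getD_eq_headD_filter {α : Type} (p : α → Bool) (l : List α) (d : α) : (l.find? p).getD d = (l.filter p).headD d := by
  rw [List.headD_eq_head?_getD, List.head?_filter]

/-- **The power search with capped powers and a unary bound.** [cite: AharonovArad2011, §3.3] -/
def findJCap (cap p q : ℕ) (u : List Unit) (c : Cand Letter) : ℕ :=
  (((List.range u.length).map (· + 1)).filter fun j => reachTest p q (powCap cap c (min j u.length))).headD u.length

/-- **`findJCap = findJ` below the cap.** [folklore] -/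
theorem findJCap_eq {cap p q : ℕ} {u : List Unit} {c : Cand Letter} (h : ∀ k ≤ u.length, (candE (c.pow k)).length ≤ cap) :
    findJCap cap p q u c = findJ p q u.length c := by
  rw [findJ, find?_getD_eq_headD_filter, findJCap]
  congr 1
  refine List.filter_congr fun j hj => ?_
  obtain ⟨i, hi, rfl⟩ := List.mem_map.1 hj
  rw [List.mem_range] at hi
  rw [Nat.min_eq_left (by omega), powCap_eq_pow fun k hk => h k (by omega)]

/-- **The capped power search is typed polynomial time.** [cite: AharonovArad2011, §3.3] -/
theorem findJCap_codeFP : CodeFP (pairE (pairE unE (pairE natE natE)) (pairE (rawE unitE) candE)) natE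
    (fun t => findJCap t.1.1 t.1.2.1 t.1.2.2 t.2.1 t.2.2) := by
  -- context `κ = ((cap, (p, q)), (u, c))`, items `j`
  have hr : CodeFP (pairE (pairE unE (pairE natE natE)) (pairE (rawE unitE) candE)) (rawE natE) (fun t => List.range t.2.1.length) :=
    urange.comp ((ulength unitE).comp (snd _ _).fst')
  have hs : CodeFP (pairE unE natE) natE (fun q => q.2 + 1) := by exact (natAdd.comp ((snd _ _).pair (const _ 1)) :)
  have hjs : CodeFP (pairE (pairE unE (pairE natE natE)) (pairE (rawE unitE) candE)) (rawE natE)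
      (fun t => (List.range t.2.1.length).map (· + 1)) := by
    exact (((CodeFP.map (σ := ℕ) (eσ := unE) hs).comp ((const _ 0).pair hr)).congr fun t => rfl)
  have hj : CodeFP (pairE (pairE (pairE unE (pairE natE natE)) (pairE (rawE unitE) candE)) natE) unE (fun s => min s.2 s.1.2.1.length) :=
    unOfNatMin.comp ((((ulength unitE).comp (fst _ _).snd'.fst')).pair (snd _ _))
  have hargs : CodeFP (pairE (pairE (pairE unE (pairE natE natE)) (pairE (rawE unitE) candE)) natE) (pairE (pairE unE candE) unE)
      (fun s => ((s.1.1.1, s.1.2.2), min s.2 s.1.2.1.length)) := (((fst _ _).fst'.fst').pair (fst _ _).snd'.snd').pair hj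
  have hpow : CodeFP (pairE (pairE (pairE unE (pairE natE natE)) (pairE (rawE unitE) candE)) natE) candE
      (fun s => powCap s.1.1.1 s.1.2.2 (min s.2 s.1.2.1.length)) := (powCap_codeFP.comp hargs).congr fun _ => rfl
  have hargs2 : CodeFP (pairE (pairE (pairE unE (pairE natE natE)) (pairE (rawE unitE) candE)) natE) (pairE (pairE natE natE) candE)
      (fun s => ((s.1.1.2.1, s.1.1.2.2), powCap s.1.1.1 s.1.2.2 (min s.2 s.1.2.1.length))) :=
    (((fst _ _).fst'.snd'.fst').pair ((fst _ _).fst'.snd'.snd')).pair hpow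
  have hpred : CodeFP (pairE (pairE (pairE unE (pairE natE natE)) (pairE (rawE unitE) candE)) natE) bitE
      (fun s => reachTest s.1.1.2.1 s.1.1.2.2 (powCap s.1.1.1 s.1.2.2 (min s.2 s.1.2.1.length))) :=
    (reachTest_codeFP.comp hargs2).congr fun _ => rfl
  have hargs3 : CodeFP (pairE (pairE unE (pairE natE natE)) (pairE (rawE unitE) candE))
      (pairE (pairE (pairE unE (pairE natE natE)) (pairE (rawE unitE) candE)) (rawE natE)) (fun t => (t, (List.range t.2.1.length).map (· + 1))) :=
    (CodeFP.id _).pair hjs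
  have hfil : CodeFP (pairE (pairE unE (pairE natE natE)) (pairE (rawE unitE) candE)) (rawE natE)
      (fun t => ((List.range t.2.1.length).map (· + 1)).filter fun j => reachTest t.1.2.1 t.1.2.2 (powCap t.1.1 t.2.2 (min j t.2.1.length))) :=
    ((CodeFP.filter hpred).comp hargs3).congr fun _ => rfl
  have hdef : CodeFP (pairE (pairE unE (pairE natE natE)) (pairE (rawE unitE) candE)) natE (fun t => t.2.1.length) :=
    (natLength unitE).comp (snd _ _).fst'
  have hargs4 : CodeFP (pairE (pairE unE (pairE natE natE)) (pairE (rawE unitE) candE)) (pairE natE (rawE natE))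
      (fun t => (t.2.1.length, ((List.range t.2.1.length).map (· + 1)).filter fun j =>
        reachTest t.1.2.1 t.1.2.2 (powCap t.1.1 t.2.2 (min j t.2.1.length)))) := hdef.pair hfil
  exact ((rawHeadOr natE).comp hargs4).congr fun _ => rfl

/-! ### The candidates of a level -/

/-- `flatMap` along functions agreeing on the list. [folklore] -/
theorem flatMap_congr_mem {α β : Type} {l : List α} {f g : α → List β} (h : ∀ x ∈ l, f x = g x) : l.flatMap f = l.flatMap g := by
  induction l with
  | nil => rfl
  | cons a l ih =>
    rw [List.flatMap_cons, List.flatMap_cons, h a (by simp), ih fun x hx => h x (List.mem_cons_of_mem _ hx)]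

/-- **The candidates of a level with capped powers** (`J` in unary). [cite: AharonovArad2011, §3.3] -/
def levelCandsCap (cap : ℕ) (net : List (Cand Letter)) (c : Cand Letter) (uJ : List Unit) : List (Cand Letter) :=
  net.flatMap fun V => (List.range (uJ.length + 1)).flatMap fun j =>
    [V.conj (powCap cap c (min j uJ.length)), V.conj (powCap cap c.inv (min j uJ.length))]

/-- **`levelCandsCap = levelCands` below the cap.** [folklore] -/
theorem levelCandsCap_eq {cap : ℕ} {net : List (Cand Letter)} {c : Cand Letter} {uJ : List Unit}
    (h : ∀ k ≤ uJ.length, (candE (c.pow k)).length ≤ cap ∧ (candE (c.inv.pow k)).length ≤ cap) :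
    levelCandsCap cap net c uJ = levelCands net c uJ.length := by
  unfold levelCandsCap levelCands
  refine flatMap_congr_mem fun V _ => flatMap_congr_mem fun j hj => ?_
  rw [List.mem_range] at hj
  rw [Nat.min_eq_left (by omega), powCap_eq_pow fun k hk => (h k (by omega)).1, powCap_eq_pow fun k hk => (h k (by omega)).2]

/-- `flatMap` as `flatten ∘ map`. [folklore] -/
theorem flatMap_eq_flatten_map {α β : Type} (l : List α) (f : α → List β) : l.flatMap f = (l.map f).flatten := by
  induction l with
  | nil => rfl
  | cons a l ih => rw [List.flatMap_cons, List.map_cons, List.flatten_cons, ih]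

/-- **The capped level candidates are typed polynomial time** (layout `(((cap, c), uJ), net)`). [cite: AharonovArad2011, §3.3] -/
theorem levelCandsCap_codeFP : CodeFP (pairE (pairE (pairE unE candE) (rawE unitE)) (rawE candE)) (rawE candE)
    (fun t => levelCandsCap t.1.1.1 t.2 t.1.1.2 t.1.2) := by
  -- inner item: context `((κ, V), j)` with `κ = ((cap, c), uJ)`
  have hκV_cap : CodeFP (pairE (pairE (pairE (pairE unE candE) (rawE unitE)) candE) natE) unE (fun s => s.1.1.1.1) := (fst _ _).fst'.fst'.fst'
  have hκV_c : CodeFP (pairE (pairE (pairE (pairE unE candE) (rawE unitE)) candE) natE) candE (fun s => s.1.1.1.2) := (fst _ _).fst'.fst'.snd'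
  have hκV_V : CodeFP (pairE (pairE (pairE (pairE unE candE) (rawE unitE)) candE) natE) candE (fun s => s.1.2) := (fst _ _).snd'
  have hκV_j : CodeFP (pairE (pairE (pairE (pairE unE candE) (rawE unitE)) candE) natE) unE (fun s => min s.2 s.1.1.2.length) :=
    unOfNatMin.comp ((((ulength unitE).comp (fst _ _).fst'.snd')).pair (snd _ _))
  have ha1 : CodeFP (pairE (pairE (pairE (pairE unE candE) (rawE unitE)) candE) natE) (pairE (pairE unE candE) unE)
      (fun s => ((s.1.1.1.1, s.1.1.1.2), min s.2 s.1.1.2.length)) := (hκV_cap.pair hκV_c).pair hκV_j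
  have hp1 : CodeFP (pairE (pairE (pairE (pairE unE candE) (rawE unitE)) candE) natE) candE
      (fun s => powCap s.1.1.1.1 s.1.1.1.2 (min s.2 s.1.1.2.length)) := (powCap_codeFP.comp ha1).congr fun _ => rfl
  have ha2 : CodeFP (pairE (pairE (pairE (pairE unE candE) (rawE unitE)) candE) natE) (pairE (pairE unE candE) unE)
      (fun s => ((s.1.1.1.1, s.1.1.1.2.inv), min s.2 s.1.1.2.length)) := (hκV_cap.pair (candInv' hκV_c)).pair hκV_j
  have hp2 : CodeFP (pairE (pairE (pairE (pairE unE candE) (rawE unitE)) candE) natE) candE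
      (fun s => powCap s.1.1.1.1 s.1.1.1.2.inv (min s.2 s.1.1.2.length)) := (powCap_codeFP.comp ha2).congr fun _ => rfl
  have hitem : CodeFP (pairE (pairE (pairE (pairE unE candE) (rawE unitE)) candE) natE) (rawE candE)
      (fun s => [s.1.2.conj (powCap s.1.1.1.1 s.1.1.1.2 (min s.2 s.1.1.2.length)), s.1.2.conj (powCap s.1.1.1.1 s.1.1.1.2.inv (min s.2 s.1.1.2.length))]) := by
    have h2 : CodeFP (pairE (pairE (pairE (pairE unE candE) (rawE unitE)) candE) natE) (rawE candE)
        (fun s => [s.1.2.conj (powCap s.1.1.1.1 s.1.1.1.2.inv (min s.2 s.1.1.2.length))]) := (rawSingleton candE).comp (candConj' hκV_V hp2)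
    have ha : CodeFP (pairE (pairE (pairE (pairE unE candE) (rawE unitE)) candE) natE) (pairE candE (rawE candE))
        (fun s => (s.1.2.conj (powCap s.1.1.1.1 s.1.1.1.2 (min s.2 s.1.1.2.length)), [s.1.2.conj (powCap s.1.1.1.1 s.1.1.1.2.inv (min s.2 s.1.1.2.length))])) :=
      (candConj' hκV_V hp1).pair h2
    exact ((rawCons candE).comp ha).congr fun _ => rfl
  -- the inner list over `j < |uJ| + 1`
  have hrange : CodeFP (pairE (pairE (pairE unE candE) (rawE unitE)) candE) (rawE natE) (fun r => List.range (r.1.2.length + 1)) :=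
    urange.comp (unSucc.comp ((ulength unitE).comp (fst _ _).snd'))
  have ha3 : CodeFP (pairE (pairE (pairE unE candE) (rawE unitE)) candE)
      (pairE (pairE (pairE (pairE unE candE) (rawE unitE)) candE) (rawE natE)) (fun r => (r, List.range (r.1.2.length + 1))) := (CodeFP.id _).pair hrange
  have hinner : CodeFP (pairE (pairE (pairE unE candE) (rawE unitE)) candE) (rawE candE)
      (fun r => ((List.range (r.1.2.length + 1)).map fun j => [r.2.conj (powCap r.1.1.1 r.1.1.2 (min j r.1.2.length)),
        r.2.conj (powCap r.1.1.1 r.1.1.2.inv (min j r.1.2.length))]).flatten) :=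
    ((CodeFP.flatten candE).comp ((CodeFP.map hitem).comp ha3)).congr fun _ => rfl
  -- the outer list over the net
  have ha4 : CodeFP (pairE (pairE (pairE unE candE) (rawE unitE)) (rawE candE))
      (pairE (pairE (pairE unE candE) (rawE unitE)) (rawE candE)) (fun t => (t.1, t.2)) := (fst _ _).pair (snd _ _)
  refine (((CodeFP.flatten candE).comp ((CodeFP.map hinner).comp ha4)).congr fun t => ?_)
  rw [levelCandsCap, flatMap_eq_flatten_map]
  congr 1

/-! ### One level of the descent -/

/-- **One level of the descent, capped**, with the last tower element passed explicitly and the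
search bound in unary. [cite: AharonovArad2011, §3.3] -/
def levelStepCap (cap : ℕ) (net towerL : List (Cand Letter)) (last : Cand Letter) (sc : Matrix (Fin 2) (Fin 2) K5 → ZPhiS)
    (p q : ℕ) (uJmax : List Unit) (W : Cand Letter) : Cand Letter :=
  let c := (towerL.filter (smallTest p (16 * q))).headD last
  let J := findJCap cap p q uJmax c
  let cands := levelCandsCap cap net c (List.replicate (min J uJmax.length) ())
  let X := bestBy (fun a b => ZPhiS.lt b a) (fun X => sc (X.mat * W.mat)) (cands.headD Cand.one) cands
  X.mul W

/-- `findJ ≤ Jmax`. [folklore] -/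
theorem findJ_le (p q Jmax : ℕ) (c : Cand Letter) : findJ p q Jmax c ≤ Jmax := by
  rw [findJ]
  cases h : ((List.range Jmax).map (· + 1)).find? (fun j => reachTest p q (c.pow j)) with
  | none => simp
  | some j =>
    have hj := List.mem_of_find?_eq_some h
    obtain ⟨i, hi, rfl⟩ := List.mem_map.1 hj
    rw [List.mem_range] at hi
    simp; omega

/-- **`levelStepCap = levelStep` below the cap.** [folklore] -/
theorem levelStepCap_eq {cap : ℕ} {net towerL : List (Cand Letter)} {sc : Matrix (Fin 2) (Fin 2) K5 → ZPhiS} {p q : ℕ}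
    {uJmax : List Unit} {W : Cand Letter}
    (h : ∀ c, (c ∈ towerL ∨ c = towerL.getLastD Cand.one) → ∀ k ≤ uJmax.length,
      (candE (c.pow k)).length ≤ cap ∧ (candE (c.inv.pow k)).length ≤ cap) :
    levelStepCap cap net towerL (towerL.getLastD Cand.one) sc p q uJmax W = levelStep net towerL sc p q uJmax.length W := by
  have hc : ∀ c', c' = (towerL.filter (smallTest p (16 * q))).headD (towerL.getLastD Cand.one) → (c' ∈ towerL ∨ c' = towerL.getLastD Cand.one) := by
    intro c' hc'
    rw [← find?_getD_eq_headD_filter] at hc'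
    cases hf : towerL.find? (smallTest p (16 * q)) with
    | none => rw [hf] at hc'; exact Or.inr hc'
    | some x => rw [hf] at hc'; exact Or.inl (hc' ▸ List.mem_of_find?_eq_some hf)
  simp only [levelStepCap, levelStep]
  set c := (towerL.filter (smallTest p (16 * q))).headD (towerL.getLastD Cand.one) with hcdef
  have hc' := hc c hcdef
  rw [← find?_getD_eq_headD_filter] at hcdef
  rw [← hcdef, findJCap_eq fun k hk => (h c hc' k hk).1, Nat.min_eq_left (findJ_le _ _ _ _)]
  rw [levelCandsCap_eq (fun k hk => h c hc' k (hk.trans (by rw [List.length_replicate]; exact findJ_le _ _ _ _))), List.length_replicate]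

section LevelStepFP

variable {sc : Matrix (Fin 2) (Fin 2) K5 → ZPhiS}

/-- The input layout of a level step: `((((cap, net), (towerL, last)), ((p, q), uJmax)), W)`. [folklore] -/
abbrev lsE : (((ℕ × List (Cand Letter)) × (List (Cand Letter) × Cand Letter)) × ((ℕ × ℕ) × List Unit)) × Cand Letter → List Bool :=
  pairE (pairE (pairE (pairE unE (rawE candE)) (pairE (rawE candE) candE)) (pairE (pairE natE natE) (rawE unitE))) candE

/-- **One capped level of the descent is typed polynomial time**, for a typed score. [cite: AharonovArad2011, §3.3] -/
theorem levelStepCap_codeFP (hsc : CodeFP matE zphisE sc) :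
    CodeFP lsE candE (fun t => levelStepCap t.1.1.1.1 t.1.1.1.2 t.1.1.2.1 t.1.1.2.2 sc t.1.2.1.1 t.1.2.1.2 t.1.2.2 t.2) := by
  have hcap : CodeFP lsE unE (fun t => t.1.1.1.1) := (fst _ _).fst'.fst'.fst'
  have hnet : CodeFP lsE (rawE candE) (fun t => t.1.1.1.2) := (fst _ _).fst'.fst'.snd'
  have htow : CodeFP lsE (rawE candE) (fun t => t.1.1.2.1) := (fst _ _).fst'.snd'.fst'
  have hlast : CodeFP lsE candE (fun t => t.1.1.2.2) := (fst _ _).fst'.snd'.snd'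
  have hp : CodeFP lsE natE (fun t => t.1.2.1.1) := (fst _ _).snd'.fst'.fst'
  have hq : CodeFP lsE natE (fun t => t.1.2.1.2) := (fst _ _).snd'.fst'.snd'
  have hu : CodeFP lsE (rawE unitE) (fun t => t.1.2.2) := (fst _ _).snd'.snd'
  have hW : CodeFP lsE candE (fun t => t.2) := snd _ _
  -- `c`
  have hq16 : CodeFP lsE natE (fun t => 16 * t.1.2.1.2) := by exact (natMul.comp ((const _ 16).pair hq) :)
  have hpredArgs : CodeFP (pairE (pairE natE natE) candE) (pairE (pairE natE natE) candE) (fun s => ((s.1.1, s.1.2), s.2)) :=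
    ((fst _ _).fst'.pair (fst _ _).snd').pair (snd _ _)
  have hpred : CodeFP (pairE (pairE natE natE) candE) bitE (fun s => smallTest s.1.1 s.1.2 s.2) := (smallTest_codeFP.comp hpredArgs).congr fun _ => rfl
  have hfilArgs : CodeFP lsE (pairE (pairE natE natE) (rawE candE)) (fun t => ((t.1.2.1.1, 16 * t.1.2.1.2), t.1.1.2.1)) := (hp.pair hq16).pair htow
  have hfil : CodeFP lsE (rawE candE) (fun t => t.1.1.2.1.filter (smallTest t.1.2.1.1 (16 * t.1.2.1.2))) :=
    ((CodeFP.filter hpred).comp hfilArgs).congr fun _ => rfl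
  have hcArgs : CodeFP lsE (pairE candE (rawE candE)) (fun t => (t.1.1.2.2, t.1.1.2.1.filter (smallTest t.1.2.1.1 (16 * t.1.2.1.2)))) := hlast.pair hfil
  have hc : CodeFP lsE candE (fun t => (t.1.1.2.1.filter (smallTest t.1.2.1.1 (16 * t.1.2.1.2))).headD t.1.1.2.2) :=
    ((rawHeadOr candE).comp hcArgs).congr fun _ => rfl
  set cOf : (((ℕ × List (Cand Letter)) × (List (Cand Letter) × Cand Letter)) × ((ℕ × ℕ) × List Unit)) × Cand Letter → Cand Letter :=
    fun t => (t.1.1.2.1.filter (smallTest t.1.2.1.1 (16 * t.1.2.1.2))).headD t.1.1.2.2 with hcOf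
  -- `J`
  have hJArgs : CodeFP lsE (pairE (pairE unE (pairE natE natE)) (pairE (rawE unitE) candE)) (fun t => ((t.1.1.1.1, (t.1.2.1.1, t.1.2.1.2)), (t.1.2.2, cOf t))) :=
    (hcap.pair (hp.pair hq)).pair (hu.pair hc)
  have hJ : CodeFP lsE natE (fun t => findJCap t.1.1.1.1 t.1.2.1.1 t.1.2.1.2 t.1.2.2 (cOf t)) := (findJCap_codeFP.comp hJArgs).congr fun _ => rfl
  set JOf : (((ℕ × List (Cand Letter)) × (List (Cand Letter) × Cand Letter)) × ((ℕ × ℕ) × List Unit)) × Cand Letter → ℕ :=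
    fun t => findJCap t.1.1.1.1 t.1.2.1.1 t.1.2.1.2 t.1.2.2 (cOf t) with hJOf
  -- `uJ`
  have huJ : CodeFP lsE (rawE unitE) (fun t => List.replicate (min (JOf t) t.1.2.2.length) ()) := unitsOfNatMin.comp (hu.pair hJ)
  -- `cands`
  have hcandsArgs : CodeFP lsE (pairE (pairE (pairE unE candE) (rawE unitE)) (rawE candE))
      (fun t => (((t.1.1.1.1, cOf t), List.replicate (min (JOf t) t.1.2.2.length) ()), t.1.1.1.2)) := ((hcap.pair hc).pair huJ).pair hnet
  have hcands : CodeFP lsE (rawE candE) (fun t => levelCandsCap t.1.1.1.1 t.1.1.1.2 (cOf t) (List.replicate (min (JOf t) t.1.2.2.length) ())) :=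
    (levelCandsCap_codeFP.comp hcandsArgs).congr fun _ => rfl
  set candsOf : (((ℕ × List (Cand Letter)) × (List (Cand Letter) × Cand Letter)) × ((ℕ × ℕ) × List Unit)) × Cand Letter → List (Cand Letter) :=
    fun t => levelCandsCap t.1.1.1.1 t.1.1.1.2 (cOf t) (List.replicate (min (JOf t) t.1.2.2.length) ()) with hcandsOf
  -- `X`
  have hgt : CodeFP (pairE zphisE zphisE) bitE (fun p => ZPhiS.lt p.2 p.1) := zphisLt' (snd _ _) (fst _ _)
  have hkey : CodeFP (pairE candE candE) zphisE (fun s => sc (s.2.mat * s.1.mat)) := hsc.comp (matMul' (candMat (snd _ _)) (candMat (fst _ _)))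
  have hbest := bestByCtx (fun a b => ZPhiS.lt b a) hgt hkey
  have hd : CodeFP lsE candE (fun t => (candsOf t).headD Cand.one) := by
    exact (((rawHeadOr candE).comp ((const _ Cand.one).pair hcands)).congr fun _ => rfl)
  have hXArgs : CodeFP lsE (pairE (pairE candE candE) (rawE candE)) (fun t => ((t.2, (candsOf t).headD Cand.one), candsOf t)) := (hW.pair hd).pair hcands
  have hX : CodeFP lsE candE (fun t => bestBy (fun a b => ZPhiS.lt b a) (fun X => sc (X.mat * t.2.mat)) ((candsOf t).headD Cand.one) (candsOf t)) :=
    (hbest.comp hXArgs).congr fun _ => rfl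
  exact (candMul' hX hW).congr fun t => by simp only [levelStepCap, hcOf, hJOf, hcandsOf]

/-- **The initial approximation is typed polynomial time.** [cite: AharonovArad2011, §3.3] -/
theorem initW_codeFP (hsc : CodeFP matE zphisE sc) : CodeFP (rawE candE) candE (fun net => initW net sc) := by
  have hgt : CodeFP (pairE zphisE zphisE) bitE (fun p => ZPhiS.lt p.2 p.1) := zphisLt' (snd _ _) (fst _ _)
  have hkey : CodeFP (pairE unitE candE) zphisE (fun s => sc s.2.mat) := hsc.comp (candMat (snd _ _))
  have hbest := bestByCtx (fun a b => ZPhiS.lt b a) hgt hkey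
  have hd : CodeFP (rawE candE) candE (fun net => net.headD Cand.one) := by
    exact (((rawHeadOr candE).comp ((const _ Cand.one).pair (CodeFP.id _))).congr fun _ => rfl)
  have hArgs : CodeFP (rawE candE) (pairE (pairE unitE candE) (rawE candE)) (fun net => (((), net.headD Cand.one), net)) :=
    ((const _ ()).pair hd).pair (CodeFP.id _)
  exact (hbest.comp hArgs).congr fun _ => rfl

/-! ### The descent and the compiler -/

/-- The context of the descent: `(((cap, net), (towerL, last)), uJmax)`. [folklore] -/
abbrev DCtx : Type := ((ℕ × List (Cand Letter)) × (List (Cand Letter) × Cand Letter)) × List Unit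

/-- Its code. [folklore] -/
abbrev dctxE : DCtx → List Bool := pairE (pairE (pairE unE (rawE candE)) (pairE (rawE candE) candE)) (rawE unitE)

/-- **The capped descent** along a list of scales `(p, q)`. [cite: AharonovArad2011, §3.3] -/
def descendCap (sc : Matrix (Fin 2) (Fin 2) K5 → ZPhiS) (κ : DCtx) (pqs : List (ℕ × ℕ)) (W₀ : Cand Letter) : Cand Letter :=
  foldlCap candE κ.1.1.1 (fun (κ : DCtx) (pq : ℕ × ℕ) W => levelStepCap κ.1.1.1 κ.1.1.2 κ.1.2.1 κ.1.2.2 sc pq.1 pq.2 κ.2 W) κ pqs W₀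

/-- **The capped descent is typed polynomial time.** [cite: AharonovArad2011, §3.3] -/
theorem descendCap_codeFP (hsc : CodeFP matE zphisE sc) :
    CodeFP (pairE dctxE (rawE (pairE natE natE))) candE (fun p => descendCap sc p.1 p.2 (initW p.1.1.1.2 sc)) := by
  have hArgs : CodeFP (pairE dctxE (pairE (pairE natE natE) candE)) lsE
      (fun s => ((((s.1.1.1.1, s.1.1.1.2), (s.1.1.2.1, s.1.1.2.2)), ((s.2.1.1, s.2.1.2), s.1.2)), s.2.2)) :=
    (((((fst _ _).fst'.fst'.fst').pair (fst _ _).fst'.fst'.snd').pair (((fst _ _).fst'.snd'.fst').pair (fst _ _).fst'.snd'.snd')).pair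
      ((((snd _ _).fst'.fst').pair (snd _ _).fst'.snd').pair (fst _ _).snd')).pair (snd _ _).snd'
  have hstep : CodeFP (pairE dctxE (pairE (pairE natE natE) candE)) candE
      (fun s => levelStepCap s.1.1.1.1 s.1.1.1.2 s.1.1.2.1 s.1.1.2.2 sc s.2.1.1 s.2.1.2 s.1.2 s.2.2) :=
    ((levelStepCap_codeFP hsc).comp hArgs).congr fun _ => rfl
  have hinit : CodeFP dctxE candE (fun κ => initW κ.1.1.2 sc) := (initW_codeFP hsc).comp (fst _ _).fst'.snd'
  have h := foldlCap_codeFP (eβ := candE) (eα := pairE natE natE) (σ := DCtx) (eσ := dctxE)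
    (step := fun (κ : DCtx) (pq : ℕ × ℕ) W => levelStepCap κ.1.1.1 κ.1.1.2 κ.1.2.1 κ.1.2.2 sc pq.1 pq.2 κ.2 W)
    (init := fun κ => initW κ.1.1.2 sc) hstep hinit
  have hArgs2 : CodeFP (pairE dctxE (rawE (pairE natE natE))) (pairE (pairE unE dctxE) (rawE (pairE natE natE)))
      (fun p => ((p.1.1.1.1, p.1), p.2)) := (((fst _ _).fst'.fst'.fst').pair (fst _ _)).pair (snd _ _)
  exact (h.comp hArgs2).congr fun _ => rfl

/-- **The capped compiler**: capped tower, then capped descent from the best net element. [cite: AharonovArad2011, §3.3] -/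
def compileCap (sc : Matrix (Fin 2) (Fin 2) K5 → ZPhiS) (cap : ℕ) (net : List (Cand Letter)) (c₀ : Cand Letter) (S : ℕ)
    (uJmax : List Unit) (pqs : List (ℕ × ℕ)) : Cand Letter :=
  let tl := towerCap cap net c₀ S
  descendCap sc (((cap, net), tl), uJmax) pqs (initW net sc)

/-- **The capped compiler is typed polynomial time**; input layout `(((cap, net), (c₀, S)), (uJmax, pqs))`.
[cite: AharonovArad2011, §3.3] -/
theorem compileCap_codeFP (hsc : CodeFP matE zphisE sc) :
    CodeFP (pairE (pairE (pairE unE (rawE candE)) (pairE candE unE)) (pairE (rawE unitE) (rawE (pairE natE natE)))) candE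
      (fun t => compileCap sc t.1.1.1 t.1.1.2 t.1.2.1 t.1.2.2 t.2.1 t.2.2) := by
  have htl : CodeFP (pairE (pairE (pairE unE (rawE candE)) (pairE candE unE)) (pairE (rawE unitE) (rawE (pairE natE natE)))) (pairE (rawE candE) candE)
      (fun t => towerCap t.1.1.1 t.1.1.2 t.1.2.1 t.1.2.2) := towerCap_codeFP.comp (fst _ _)
  have hArgs : CodeFP (pairE (pairE (pairE unE (rawE candE)) (pairE candE unE)) (pairE (rawE unitE) (rawE (pairE natE natE)))) (pairE dctxE (rawE (pairE natE natE)))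
      (fun t => ((((t.1.1.1, t.1.1.2), towerCap t.1.1.1 t.1.1.2 t.1.2.1 t.1.2.2), t.2.1), t.2.2)) :=
    ((((fst _ _).fst'.fst'.pair (fst _ _).fst'.snd').pair htl).pair (snd _ _).fst').pair (snd _ _).snd'
  exact ((descendCap_codeFP hsc).comp hArgs).congr fun _ => rfl

/-- **`compileCap = compile` below the cap.** [folklore] -/
theorem compileCap_eq {cap : ℕ} {net : List (Cand Letter)} {c₀ : Cand Letter} {S : ℕ} {uJmax : List Unit} {pqs : List (ℕ × ℕ)}
    (hc₀ : (tower net c₀ S).getLastD c₀ = (tower net c₀ S).getLastD Cand.one)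
    (hT : ∀ j ≤ S, (pairE (rawE candE) candE (tower net c₀ j, (tower net c₀ j).getLastD c₀)).length ≤ cap)
    (hP : ∀ c, (c ∈ tower net c₀ S ∨ c = (tower net c₀ S).getLastD Cand.one) → ∀ k ≤ uJmax.length,
      (candE (c.pow k)).length ≤ cap ∧ (candE (c.inv.pow k)).length ≤ cap)
    (hD : ∀ l₁ l₂ : List (ℕ × ℕ), l₁ ++ l₂ = pqs →
      (candE (descend net (tower net c₀ S) sc (l₁.map fun pq => (pq.1, pq.2, uJmax.length)) (initW net sc))).length ≤ cap) :
    compileCap sc cap net c₀ S uJmax pqs = compile net c₀ S sc (pqs.map fun pq => (pq.1, pq.2, uJmax.length)) := by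
  simp only [compileCap, compile]
  rw [towerCap_eq hT, descendCap]
  have hstep : ∀ (W : Cand Letter) (pq : ℕ × ℕ),
      levelStepCap cap net (tower net c₀ S) ((tower net c₀ S).getLastD c₀) sc pq.1 pq.2 uJmax W =
        levelStep net (tower net c₀ S) sc pq.1 pq.2 uJmax.length W := by
    intro W pq; rw [hc₀]; exact levelStepCap_eq hP
  rw [foldlCap_eq_foldl]
  · rw [descend, List.foldl_map]
    simp only [hstep]
  · intro l₁ l₂ hl
    have := hD l₁ l₂ hl
    rw [descend, List.foldl_map] at this
    simp only [hstep]
    exact this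

end LevelStepFP

end Literature.Computability.QuantumComplexity
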